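import Literature.NumberTheory.PAdicHodge.UnramifiedWittPeriodMatrix
import HarnessLib

/-!
# The period matrix over `W(k̄)` of a potentially unramified `p`-adic representation

Let `F` be a non-archimedean local field of residue characteristic `p`, `k̄` the residue field of
`𝒪̂_{F^nr}` with its `Γ_F`-action and `W(k̄)` its Witt vectors (files `UnramifiedWittVectors`,
`UnramifiedWittPeriodMatrix`).  The accepted `exists_isUnit_forall_eq_mul_wittGal` produces, for a
continuous UNRAMIFIED `r : Γ_F →ₜ* GL_N(ℤ_p)`, an invertible `X ∈ M_N(W(k̄))` with
`X = R(σ) · 𝕎(σ̄)(X)` for all `σ ∈ Γ_F` (Lang's theorem over `W(k̄)` for an arithmetic Frobenius `σ₀`,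
then density of `σ₀^ℕ I_F`).  Here the same is done for a POTENTIALLY unramified `r` — trivial on
`Γ' ∩ I_F` for an open normal subgroup `Γ' ≤ Γ_F` of index `m` — on the open normal subgroup
`Γ'' = Γ' ∩ Fix(μ_{q^m-1})` (`= Γ' ∩ Γ_{F_m}`, `F_m/F` unramified of degree `m`):

* `exists_isUnit_forall_mem_eq_mul_wittGal` — **there is an invertible `X ∈ M_N(W(k̄))` with
  `X = R(σ) · 𝕎(σ̄)(X)` for every `σ ∈ Γ'` fixing `μ_{q^m-1}`.**

Proof: Lang's theorem for `τ₀ = σ₀^m ∈ Γ'` (`IsAbsArithFrob.exists_isUnit_eq_mul_wittGal_pow`: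
`τ̄₀ = (·)^{q^m}` on `k̄`); every `σ ∈ Γ''` acts on the prime-to-`p` roots of unity as `ζ ↦ ζ^{q^a}`
(`exists_smul_rootOfUnity_eq_pow`) with `m ∣ a` because `σ` fixes a primitive `(q^m-1)`-th root
(`Nat.dvd_of_pow_sub_one_dvd_pow_sub_one`), so `σ ≡ τ₀^{a/m}` on any `F(μ_M)` while
`(τ₀^{a/m})⁻¹ σ ∈ Γ'' ∩ Fix(μ_{M₂})`, which lies in the open congruence set `{r ≡ 1 mod p^k} ⊇ Γ'' ∩ I_F`
for `M₂` large (relative cofinality `exists_inter_fixing_rootsOfUnity_subset`, compactness); then the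
abstract descent `MatCong.self_of_map_cong_of_cong_one` of `UnramifiedWittPeriodMatrix` verbatim.
This is the first step of "potentially unramified (= potentially crystalline of weight `0`)
representations are de Rham" (Fontaine 1994, Exp. III §1.5–1.6, §5; Brinon–Conrad Prop. 6.3.8),
towards the input (PU) of `HeckeCharacter.exists_lAdic_isDeRhamFramed_of_local`
(`WeilLAdicCharacterDeRhamReduction`).  No definitions besides theorems; no named facts.

## References
* [FontaineAsterisque223III] J.-M. Fontaine, Astérisque 223 (1994), Exp. III §1.5–§1.6, §5.
* [SerreLocalFields1979] J.-P. Serre, *Local Fields*, GTM 67, Ch. IV §4 (Prop. 16, Cor. 2), Ch. XIII §5.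
* [BrinonConrad2009] O. Brinon, B. Conrad, *CMI notes on p-adic Hodge theory* (2009), Prop. 6.3.8.
-/

noncomputable section

open WittVector IsLocalRing Matrix Field ValuativeRel
open scoped ValuativeRel MatrixGroups

namespace Literature.NumberTheory.PAdicHodge

open Literature.NumberTheory.GaloisRepresentations
open Literature.NumberTheory.GaloisRepresentations.IsNonarchimedeanLocalField

variable {F : Type} [Field F] [ValuativeRel F] [TopologicalSpace F] [IsNonarchimedeanLocalField F]
  {p : ℕ} [Fact p.Prime]

/-! ### §1. Relative cofinality of the fixators of `μ_M` -/

omit [Fact p.Prime] in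
/-- **Relative cofinality**: for a closed `C ⊆ Gal(F̄/F)` and an open `U ⊇ C ∩ I_F`, some
`C ∩ Fix(μ_M)` (`M` prime to `p`) lies in `U` (`C ∩ I_F = ⋂_M C ∩ Fix(μ_M)`, a directed intersection of
closed sets of the compact `Gal(F̄/F)`). [cite: SerreLocalFields1979, Ch. IV §4 Cor. 2 to Prop. 16] -/
theorem exists_inter_fixing_rootsOfUnity_subset {C U : Set (absoluteGaloisGroup F)} (hC : IsClosed C)
    (hU : IsOpen U) (hIU : C ∩ (absInertia F : Set (absoluteGaloisGroup F)) ⊆ U) :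
    ∃ M : ℕ, IsUnit ((M : ℕ) : 𝒪[F]) ∧
      C ∩ {σ : absoluteGaloisGroup F | ∀ ζ : AlgebraicClosure F, ζ ^ M = 1 → σ • ζ = ζ} ⊆ U := by
  haveI : CompactSpace (absoluteGaloisGroup F) := absoluteGaloisGroup_compactSpace F
  let ι := {M : ℕ // IsUnit ((M : ℕ) : 𝒪[F])}
  haveI : Nonempty ι := ⟨⟨1, by simp⟩⟩
  let Z : ι → Set (absoluteGaloisGroup F) := fun M =>
    C ∩ {σ | ∀ ζ : AlgebraicClosure F, ζ ^ (M : ℕ) = 1 → σ • ζ = ζ}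
  have hZc : ∀ M, IsClosed (Z M) := fun M => hC.inter (isClosed_setOf_forall_smul_rootOfUnity (F := F) M)
  have hZI : (⋂ M, Z M) = C ∩ (absInertia F : Set (absoluteGaloisGroup F)) := by
    ext σ
    simp only [Z, Set.mem_iInter, Set.mem_inter_iff, Set.mem_setOf_eq, SetLike.mem_coe,
      mem_absInertia_iff_smul_rootsOfUnity]
    exact ⟨fun h => ⟨(h ⟨1, by simp⟩).1, fun N hN ζ hζ => (h ⟨N, hN⟩).2 ζ hζ⟩,
      fun h M => ⟨h.1, fun ζ hζ => h.2 M M.2 ζ hζ⟩⟩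
  have hdir : Directed (· ⊇ ·) Z := by
    intro M₁ M₂
    refine ⟨⟨M₁ * M₂, by rw [Nat.cast_mul]; exact M₁.2.mul M₂.2⟩, ?_, ?_⟩
    · rintro σ ⟨hσC, hσ⟩
      exact ⟨hσC, fun ζ hζ => hσ ζ (show ζ ^ ((M₁ : ℕ) * (M₂ : ℕ)) = 1 by rw [pow_mul, hζ, one_pow])⟩
    · rintro σ ⟨hσC, hσ⟩
      exact ⟨hσC, fun ζ hζ => hσ ζ (show ζ ^ ((M₁ : ℕ) * (M₂ : ℕ)) = 1 by rw [mul_comm, pow_mul, hζ, one_pow])⟩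
  have hs : IsCompact Uᶜ := hU.isClosed_compl.isCompact
  have hsZ : Uᶜ ∩ ⋂ M, Z M = ∅ := by
    rw [hZI, Set.eq_empty_iff_forall_notMem]
    rintro σ ⟨hσU, hσI⟩
    exact hσU (hIU hσI)
  obtain ⟨M, hM⟩ := hs.elim_directed_family_closed Z hZc hsZ hdir
  refine ⟨M, M.2, fun σ hσ => ?_⟩
  by_contra hσU
  have : σ ∈ Uᶜ ∩ Z M := ⟨hσU, hσ⟩
  rw [hM] at this
  exact this

/-! ### §2. `q^m - 1 ∣ q^a - 1 ⇒ m ∣ a` -/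

omit [Fact p.Prime] in
/-- For `q ≥ 2` and `m ≥ 1`: if `q^m - 1 ∣ q^a - 1` then `m ∣ a`. [folklore] -/
theorem _root_.Nat.dvd_of_pow_sub_one_dvd_pow_sub_one {q m a : ℕ} (hq : 2 ≤ q) (hm : 0 < m)
    (h : q ^ m - 1 ∣ q ^ a - 1) : m ∣ a := by
  -- write `a = m b + c`, `c < m`; then `q^m - 1 ∣ q^c - 1 < q^m - 1`
  set b := a / m
  set c := a % m
  have hac : a = m * b + c := (Nat.div_add_mod a m).symm
  have hcm : c < m := Nat.mod_lt a hm
  have h1 : q ^ m - 1 ∣ q ^ (m * b) - 1 := Nat.pow_sub_one_dvd_pow_sub_one q (dvd_mul_right m b)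
  have hq1 : 1 ≤ q ^ c := Nat.one_le_pow _ _ (by omega)
  have hqmb : 1 ≤ q ^ (m * b) := Nat.one_le_pow _ _ (by omega)
  have hsplit : q ^ a - 1 = q ^ c * (q ^ (m * b) - 1) + (q ^ c - 1) := by
    rw [hac, pow_add, Nat.mul_sub, mul_one, mul_comm (q ^ (m * b)) (q ^ c)]
    have : q ^ c ≤ q ^ c * q ^ (m * b) := Nat.le_mul_of_pos_right _ (by omega)
    omega
  have h2 : q ^ m - 1 ∣ q ^ c - 1 := by
    have h3 : q ^ m - 1 ∣ q ^ c * (q ^ (m * b) - 1) := dvd_mul_of_dvd_right h1 _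
    rw [hsplit] at h
    exact (Nat.dvd_add_right h3).mp h
  have hlt : q ^ c - 1 < q ^ m - 1 := by
    have : q ^ c < q ^ m := Nat.pow_lt_pow_right (by omega) hcm
    omega
  have hc0 : q ^ c - 1 = 0 := Nat.eq_zero_of_dvd_of_lt h2 hlt
  have hc : c = 0 := by
    by_contra hc
    have : 2 ≤ q ^ c := by
      calc 2 ≤ q := hq
        _ = q ^ 1 := (pow_one q).symm
        _ ≤ q ^ c := Nat.pow_le_pow_right (by omega) (Nat.pos_of_ne_zero hc)
    omega
  rw [hac, hc, add_zero]
  exact dvd_mul_right m b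

/-! ### §3. Units and roots of unity of order `q^m - 1` -/

omit [Fact p.Prime] in
/-- **`q^m - 1` is a unit of `𝒪_F`** (`q ≡ 0` in the residue field). [folklore] -/
theorem isUnit_natCast_residueFieldCard_pow_sub_one (m : ℕ) (hm : 0 < m) :
    IsUnit (((residueFieldCard F ^ m - 1 : ℕ) : ℕ) : 𝒪[F]) := by
  rw [← IsLocalRing.residue_ne_zero_iff_isUnit]
  have h1 : 1 ≤ residueFieldCard F ^ m := Nat.one_le_pow _ _ (by have := one_lt_residueFieldCard F; omega)
  rw [map_natCast, Nat.cast_sub h1, Nat.cast_pow, Nat.cast_one]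
  have hq : ((residueFieldCard F : ℕ) : IsLocalRing.ResidueField 𝒪[F]) = 0 := cast_residueFieldCard_eq_zero
  rw [hq, zero_pow hm.ne', zero_sub, neg_ne_zero]
  exact one_ne_zero

/-! ### §4. Powers of an arithmetic Frobenius on `k̄` -/

omit [Fact p.Prime] in
/-- `σ₀ ^ n` acts on `k̄` as `y ↦ y ^ (q ^ n)`. [folklore] -/
theorem IsAbsArithFrob.residueGal_pow_eq_pow {σ₀ : absoluteGaloisGroup F} (hσ₀ : IsAbsArithFrob σ₀) (n : ℕ)
    (y : IsLocalRing.ResidueField (maxUnramifiedCompletion F)) :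
    residueGal (σ₀ ^ n) y = y ^ residueFieldCard F ^ n := by
  induction n generalizing y with
  | zero => rw [pow_zero, residueGal_one, pow_zero, pow_one]
  | succ n ih => rw [pow_succ, residueGal_mul, IsAbsArithFrob.residueGal_eq_pow hσ₀, ih, ← pow_mul, ← pow_succ']

variable [CharP (IsLocalRing.ResidueField (maxUnramifiedCompletion F)) p] {N : ℕ}

/-- **Lang's theorem over `W(k̄)` for a POWER of an arithmetic Frobenius**: for `τ₀ = σ₀ ^ m`,
`m ≥ 1`, and invertible `G` there is an invertible `X` with `X = G · 𝕎(τ̄₀)(X)` (`τ̄₀ = (·)^{q^m}` on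
the algebraically closed `k̄`). [cite: SerreLocalFields1979, Ch. XIII §5] -/
theorem IsAbsArithFrob.exists_isUnit_eq_mul_wittGal_pow {σ₀ : absoluteGaloisGroup F} (hσ₀ : IsAbsArithFrob σ₀)
    {m : ℕ} (hm : 0 < m)
    {G : Matrix (Fin N) (Fin N) (WittVector p (IsLocalRing.ResidueField (maxUnramifiedCompletion F)))} (hG : IsUnit G) :
    ∃ X : Matrix (Fin N) (Fin N) (WittVector p (IsLocalRing.ResidueField (maxUnramifiedCompletion F))),
      IsUnit X ∧ X = G * wittGalMatrix (σ₀ ^ m) X := by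
  have hres : Function.Surjective (WittVector.constantCoeff :
      WittVector p (IsLocalRing.ResidueField (maxUnramifiedCompletion F)) →+*
        IsLocalRing.ResidueField (maxUnramifiedCompletion F)) := fun y => ⟨teichmuller p y, by simp⟩
  have hker : ∀ x : WittVector p (IsLocalRing.ResidueField (maxUnramifiedCompletion F)),
      WittVector.constantCoeff x = 0 ↔
        x ∈ Ideal.span {(p : WittVector p (IsLocalRing.ResidueField (maxUnramifiedCompletion F)))} := by
    intro x
    rw [WittVector.constantCoeff_apply, WittVector.mem_span_p_iff_coeff_zero_eq_zero]
  have hcomp : ∀ x : WittVector p (IsLocalRing.ResidueField (maxUnramifiedCompletion F)),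
      WittVector.constantCoeff (wittGal (p := p) (σ₀ ^ m) x) = residueGal (σ₀ ^ m) (WittVector.constantCoeff x) := by
    intro x
    rw [WittVector.constantCoeff_apply, WittVector.constantCoeff_apply, coeff_wittGal]
  have hπ : wittGal (F := F) (p := p) (σ₀ ^ m)
      (p : WittVector p (IsLocalRing.ResidueField (maxUnramifiedCompletion F))) = p := map_natCast _ p
  have hq : 2 ≤ residueFieldCard F ^ m := by
    calc 2 ≤ residueFieldCard F := one_lt_residueFieldCard F
      _ = residueFieldCard F ^ 1 := (pow_one _).symm
      _ ≤ residueFieldCard F ^ m := Nat.pow_le_pow_right (by have := one_lt_residueFieldCard F; omega) hm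
  exact FrobeniusSemilinear.exists_isUnit_eq_mul_map
    (p : WittVector p (IsLocalRing.ResidueField (maxUnramifiedCompletion F))) (wittGal (p := p) (σ₀ ^ m))
    WittVector.constantCoeff (residueGal (σ₀ ^ m)) hres hker
    (IsAbsArithFrob.residueGal_pow_eq_pow hσ₀ m) hq hπ hcomp hG

/-! ### §5. The period matrix of a potentially unramified representation over `W(k̄)` -/

omit [Fact p.Prime] [CharP (IsLocalRing.ResidueField (maxUnramifiedCompletion F)) p] in
/-- Roots of unity of order dividing `q^m - 1` are fixed by `ζ ↦ ζ^{q^{m c}}`. [folklore] -/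
theorem pow_residueFieldCard_pow_mul_eq_self {m c : ℕ} {ζ : AlgebraicClosure F}
    (hζ : ζ ^ (residueFieldCard F ^ m - 1) = 1) : ζ ^ residueFieldCard F ^ (m * c) = ζ := by
  have h1 : 1 ≤ residueFieldCard F ^ (m * c) := Nat.one_le_pow _ _ (by have := one_lt_residueFieldCard F; omega)
  obtain ⟨k, hk⟩ := Nat.pow_sub_one_dvd_pow_sub_one (residueFieldCard F) (dvd_mul_right m c)
  calc ζ ^ residueFieldCard F ^ (m * c) = ζ ^ (residueFieldCard F ^ (m * c) - 1 + 1) := by rw [Nat.sub_add_cancel h1]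
    _ = ζ := by rw [pow_succ, hk, pow_mul, hζ, one_pow, one_mul]

variable (r : absoluteGaloisGroup F →ₜ* GL (Fin N) ℤ_[p])

/-- **The period matrix of a potentially unramified `p`-adic representation over `W(k̄)`.**  Let
`r : Gal(F̄/F) → GL_N(ℤ_p)` be continuous and trivial on `Γ' ∩ I_F` for an open normal subgroup
`Γ' ≤ Gal(F̄/F)` of index `m`.  Then there is an invertible `X ∈ M_N(W(k̄))` with
`X = R(σ) · 𝕎(σ̄)(X)` for every `σ ∈ Γ'` fixing `μ_{q^m-1}` — i.e. on the open normal subgroup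
`Γ'' = Γ' ∩ Gal(F̄/F_m)` (`F_m/F` unramified of degree `m`): Lang's theorem for `τ₀ = σ₀^m ∈ Γ''`
(`σ₀` an arithmetic Frobenius) and the density of `τ₀^ℕ · (Γ'' ∩ I_F)` in `Γ''` (every `σ ∈ Γ''` acts on
the prime-to-`p` roots of unity as `ζ ↦ ζ^{q^a}` with `m ∣ a`). This is the `W(k̄)`-admissibility of
potentially unramified representations restricted to `Γ''` (Fontaine 1994, Exp. III §1.5–1.6).
[cite: FontaineAsterisque223III, Exp. III §1.5] [cite: SerreLocalFields1979, Ch. XIII §5] -/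
theorem exists_isUnit_forall_mem_eq_mul_wittGal (Γ' : Subgroup (absoluteGaloisGroup F)) [Γ'.Normal]
    (hΓ' : IsOpen (Γ' : Set (absoluteGaloisGroup F)))
    (hr : ∀ σ ∈ Γ', σ ∈ absInertia F → r σ = 1) :
    ∃ m : ℕ, 0 < m ∧ (∀ σ : absoluteGaloisGroup F, σ ^ m ∈ Γ') ∧
      ∃ X : Matrix (Fin N) (Fin N) (WittVector p (IsLocalRing.ResidueField (maxUnramifiedCompletion F))), IsUnit X ∧
        ∀ σ ∈ Γ', (∀ ζ : AlgebraicClosure F, ζ ^ (residueFieldCard F ^ m - 1) = 1 → σ • ζ = ζ) →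
          X = wittPeriodCoeff (p := p) r σ * wittGalMatrix σ X := by
  classical
  haveI : CompactSpace (absoluteGaloisGroup F) := absoluteGaloisGroup_compactSpace F
  haveI : Finite (absoluteGaloisGroup F ⧸ Γ') := Subgroup.quotient_finite_of_isOpen Γ' hΓ'
  set m : ℕ := Γ'.index with hmdef
  have hm : 0 < m := Nat.pos_of_ne_zero Subgroup.index_ne_zero_of_finite
  have hpowmem : ∀ σ : absoluteGaloisGroup F, σ ^ m ∈ Γ' := fun σ => Subgroup.pow_index_mem Γ' σ
  obtain ⟨σ₀, hσ₀⟩ := exists_isAbsArithFrob_holds (F := F)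
  set τ₀ : absoluteGaloisGroup F := σ₀ ^ m with hτ₀def
  have hτ₀Γ : τ₀ ∈ Γ' := hpowmem σ₀
  obtain ⟨X, hXu, hX⟩ := IsAbsArithFrob.exists_isUnit_eq_mul_wittGal_pow hσ₀ hm (isUnit_wittPeriodCoeff (p := p) r τ₀)
  refine ⟨m, hm, hpowmem, X, hXu, fun σ hσΓ hσfix => ?_⟩
  obtain ⟨V, hVR⟩ := (isUnit_wittPeriodCoeff (p := p) r τ₀).exists_left_inv
  have hq2 : 2 ≤ residueFieldCard F := one_lt_residueFieldCard F
  set Mq : ℕ := residueFieldCard F ^ m - 1 with hMq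
  have hMqu : IsUnit ((Mq : ℕ) : 𝒪[F]) := isUnit_natCast_residueFieldCard_pow_sub_one m hm
  -- `τ₀ ^ c` fixes `μ_{q^m - 1}` and acts on prime-to-`p` roots of unity as `ζ ↦ ζ^{q^{mc}}`
  have hτpow : ∀ c : ℕ, τ₀ ^ c = σ₀ ^ (m * c) := fun c => by rw [hτ₀def, ← pow_mul]
  -- congruence modulo `p ^ k` for every `k`
  refine MatCong.eq_of_forall_pow (I := Ideal.span {(p : WittVector p (IsLocalRing.ResidueField (maxUnramifiedCompletion F)))}) fun k => ?_
  choose b hb using fun y : (IsLocalRing.ResidueField (maxUnramifiedCompletion F)) => exists_residue_algebraMap_eq y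
  -- the open set `U = {τ | r τ ≡ 1 mod p ^ k}` contains `Γ'' ∩ I_F`
  set U : Set (absoluteGaloisGroup F) := {τ : absoluteGaloisGroup F | ∀ i j,
      ((r τ : GL (Fin N) ℤ_[p]) : Matrix (Fin N) (Fin N) ℤ_[p]) i j - (1 : Matrix (Fin N) (Fin N) ℤ_[p]) i j ∈
        Ideal.span {(p : ℤ_[p]) ^ k}} with hUdef
  set C : Set (absoluteGaloisGroup F) := (Γ' : Set (absoluteGaloisGroup F)) ∩
    {σ : absoluteGaloisGroup F | ∀ ζ : AlgebraicClosure F, ζ ^ Mq = 1 → σ • ζ = ζ} with hCdef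
  have hCc : IsClosed C := (Subgroup.isClosed_of_isOpen Γ' hΓ').inter (isClosed_setOf_forall_smul_rootOfUnity (F := F) Mq)
  have hIU : C ∩ (absInertia F : Set (absoluteGaloisGroup F)) ⊆ U := by
    rintro τ ⟨⟨hτΓ, -⟩, hτI⟩ i j
    rw [hr τ hτΓ hτI, Units.val_one, sub_self]
    exact zero_mem _
  obtain ⟨M₂, hM₂, hU₂⟩ := exists_inter_fixing_rootsOfUnity_subset hCc (isOpen_setOf_congr r k) hIU
  -- the finitely many Witt components of `X` below `k` lie in some `F(μ_{M₁})`
  set T : Finset (AlgebraicClosure F) := Finset.univ.image fun ijt : Fin N × Fin N × Fin k =>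
      ((b ((X ijt.1 ijt.2.1).coeff (ijt.2.2 : ℕ)) : maxUnramifiedIntegers F) : AlgebraicClosure F) with hTdef
  have hT : ∀ t ∈ T, t ∈ maxUnramified F := by
    intro t ht
    obtain ⟨ijt, -, rfl⟩ := Finset.mem_image.1 ht
    exact mem_maxUnramified_of_mem (b _).2
  obtain ⟨M₁, hM₁, hT₁⟩ := exists_subset_adjoin_rootsOfUnity T hT
  -- `σ` acts on `μ_M`, `M = M₁ M₂ (q^m - 1)`, as `ζ ↦ ζ^{q^a}` with `m ∣ a`
  have hM : IsUnit ((((M₁ * M₂ * Mq : ℕ)) : ℕ) : 𝒪[F]) := by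
    rw [Nat.cast_mul, Nat.cast_mul]; exact (hM₁.mul hM₂).mul hMqu
  obtain ⟨a, ha⟩ := exists_smul_rootOfUnity_eq_pow σ hM
  have hdvd : m ∣ a := by
    -- a primitive `(q^m-1)`-th root of unity is fixed by `σ` and sent to `ζ^{q^a}`
    have hMq0 : Mq ≠ 0 := by rintro h; rw [h] at hMqu; simp at hMqu
    haveI : NeZero ((Mq : ℕ) : AlgebraicClosure F) := ⟨by
      have hu := hMqu.map (algebraMap 𝒪[F] (AlgebraicClosure F))
      rw [map_natCast] at hu
      exact hu.ne_zero⟩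
    obtain ⟨ζ₁, hζ₁⟩ := HasEnoughRootsOfUnity.exists_primitiveRoot (AlgebraicClosure F) Mq
    have h1 : σ • ζ₁ = ζ₁ := hσfix ζ₁ hζ₁.pow_eq_one
    have h2 : σ • ζ₁ = ζ₁ ^ residueFieldCard F ^ a := ha ζ₁ (by
      rw [show M₁ * M₂ * Mq = Mq * (M₁ * M₂) by ring, pow_mul, hζ₁.pow_eq_one, one_pow])
    have h3 : ζ₁ ^ (residueFieldCard F ^ a - 1) = 1 := by
      have hqa : 1 ≤ residueFieldCard F ^ a := Nat.one_le_pow _ _ (by omega)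
      have h4 : ζ₁ ^ (residueFieldCard F ^ a - 1) * ζ₁ = 1 * ζ₁ := by
        rw [← pow_succ, Nat.sub_add_cancel hqa, ← h2, h1, one_mul]
      rw [one_mul] at h4
      exact mul_right_cancel₀ (hζ₁.ne_zero hMq0) (h4.trans (one_mul ζ₁).symm)
    exact Nat.dvd_of_pow_sub_one_dvd_pow_sub_one hq2 hm (hζ₁.dvd_of_pow_eq_one _ h3)
  obtain ⟨c, rfl⟩ := hdvd
  have hagree : ∀ ζ : AlgebraicClosure F, ζ ^ (M₁ * M₂ * Mq) = 1 → σ • ζ = τ₀ ^ c • ζ := by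
    intro ζ hζ
    rw [ha ζ hζ, hτpow, IsAbsArithFrob.pow_smul_rootOfUnity hσ₀ hM (m * c) hζ]
  -- Step 1: `σ̄` and `τ̄₀ ^ c` agree on the components of `X` below `k`
  have hcomp : ∀ (i j : Fin N) (t : ℕ), t < k →
      residueGal σ ((X i j).coeff t) = residueGal (τ₀ ^ c) ((X i j).coeff t) := by
    intro i j t ht
    rw [← hb ((X i j).coeff t), residueGal_residue_algebraMap, residueGal_residue_algebraMap]
    congr 2
    refine Subtype.ext ?_
    rw [maxUnramifiedIntegers.coe_smul, maxUnramifiedIntegers.coe_smul]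
    refine smul_eq_smul_of_mem_adjoin_rootsOfUnity (M := M₁) (fun ζ hζ => hagree ζ ?_)
      (hT₁ _ (Finset.mem_image.2 ⟨(i, j, ⟨t, ht⟩), Finset.mem_univ _, rfl⟩))
    rw [show M₁ * M₂ * Mq = M₁ * (M₂ * Mq) by ring, pow_mul, hζ, one_pow]
  -- Step 2: `(τ₀ ^ c)⁻¹ σ ∈ C ∩ Fix(μ_{M₂}) ⊆ U`
  have haU : (τ₀ ^ c)⁻¹ * σ ∈ U := by
    refine hU₂ ⟨⟨Γ'.mul_mem (Γ'.inv_mem (Γ'.pow_mem hτ₀Γ c)) hσΓ, fun ζ hζ => ?_⟩, fun ζ hζ => ?_⟩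
    · -- fixes `μ_{q^m-1}`
      have hτζ : τ₀ ^ c • ζ = ζ := by
        rw [hτpow, IsAbsArithFrob.pow_smul_rootOfUnity hσ₀ hMqu (m * c) hζ]
        exact pow_residueFieldCard_pow_mul_eq_self hζ
      rw [mul_smul, hσfix ζ hζ, ← hτζ, inv_smul_smul, hτζ]
    · -- fixes `μ_{M₂}`
      have hζ' : ζ ^ (M₁ * M₂ * Mq) = 1 := by
        rw [show M₁ * M₂ * Mq = M₂ * (M₁ * Mq) by ring, pow_mul, hζ, one_pow]
      rw [mul_smul, hagree ζ hζ', inv_smul_smul]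
  exact MatCong.self_of_map_cong_of_cong_one
    (A := WittVector p (IsLocalRing.ResidueField (maxUnramifiedCompletion F))) (Γ := absoluteGaloisGroup F)
    (wittGalMatrix (F := F) (p := p) (N := N)) (wittGalMatrix_one (F := F) (p := p) (N := N))
    (wittGalMatrix_mul (F := F) (p := p) (N := N))
    (wittPeriodCoeff (p := p) r) (wittPeriodCoeff_one (p := p) r) (wittPeriodCoeff_mul (p := p) r)
    (fun τ σ' => wittGalMatrix_wittPeriodCoeff (p := p) r τ σ') hVR hX
    (matCong_wittGalMatrix_of_forall_coeff (F := F) (p := p) hcomp) (matCong_wittPeriodCoeff_one (p := p) r haU)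

end Literature.NumberTheory.PAdicHodge

end
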